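import Literature.AlgebraicGeometry.Motives.CechH1OfSheafCohomology
import Literature.AlgebraicGeometry.Motives.FlasqueCohomology
import Literature.AlgebraicGeometry.Motives.GrothendieckVanishingPushforward
import Literature.AlgebraicGeometry.Motives.CohomologyColimitsIso

/-!
# Čech `1`-cocycles lift along a morphism of abelian sheaves which is onto on `H¹`

Stub `stub_cechOneCocycleLift` of the line `IdeatorFiveSketch` (crux
`FormalLiftingFromClassLifting`): for a morphism `φ : F ⟶ G` of sheaves of abelian groups on a
topological space `X` such that `H¹(X, F) → H¹(X, G)` (Mathlib's `Sheaf.H`, `Sheaf.H.map`) is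
surjective, a basis `B` of the topology, a point-indexed open cover `U` (`x ∈ U x`) and a Čech
`1`-cocycle `c` of `G` on `U`, there is a point-indexed refinement `W` by basic opens, a Čech
`1`-cocycle `b` of `F` on `W` and a `0`-cochain `z` of `G` on `W` with `c|_W = φ(b) + ∂z`.

## Proof

This is the injectivity of `Ȟ¹(𝔚, G) → H¹(X, G)` together with the surjectivity of
`colim_𝔚 Ȟ¹(𝔚, F) → H¹(X, F)` (Hartshorne III, Lemma 4.4 and Ex. 4.4) and the naturality of these
maps, organised as follows so that no comparison map has to be defined. Embed `F ↪ I_F`, `G ↪ I_G`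
into injective abelian sheaves (`Injective.ι`), with quotients `Q_F`, `Q_G`; extend `F → G → I_G`
over `F ↪ I_F` to `ψ : I_F → I_G` (injectivity of `I_G`) and pass to the quotients, `χ : Q_F → Q_G`:
a morphism of short exact sequences over `φ`. Since `H¹(I_G) = 0`, the cocycle `ι_G(c)` is a
coboundary `s_y - s_x` of `I_G` on `U` (`exists_cech_coboundary_of_subsingleton_H_one`), and the
images of the `s_x` in `Q_G` glue to `q_G ∈ Q_G(X)`; let `ξ_G = δ(q_G) ∈ H¹(G)`. By hypothesis
`ξ_G = H¹(φ)(ξ_F)`, and `ξ_F = δ(q_F)` with `q_F ∈ Q_F(X)` (`H¹(I_F) = 0`). As `I_F → Q_F` is an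
epimorphism, it is locally surjective: `q_F` lifts to `t_x ∈ I_F(W x)` on basic opens
`x ∈ W x ≤ U x`, and `b_{xy} = ι_F⁻¹(t_y - t_x)` is a cocycle of `F` on `W` (left exactness of
sections). By naturality of `δ`, `δ(χ q_F) = H¹(φ)(δ q_F) = ξ_G = δ(q_G)`, so `q_G - χ(q_F)` lifts
to a global section `g` of `I_G`; then `r_x = s_x|_{W x} - ψ(t_x) - g|_{W x}` is killed by
`I_G → Q_G`, hence `r_x = ι_G(z_x)`, and `ι_G(c|_W - φ(b)) = r_y - r_x = ι_G(z_y - z_x)` with `ι_G`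
injective on sections.

## References

* R. Hartshorne, *Algebraic Geometry*, GTM 52, Springer (1977): III, Lemma 4.4 and Ex. 4.4
  (PDF pp. 277, 279–280). [Hartshorne1977]
-/

set_option linter.dupNamespace false

open CategoryTheory Limits Opposite TopologicalSpace Abelian Literature.AlgebraicGeometry.Motives

universe u

namespace Summit.HodgeConjecture.HodgeConjecture.Theorems.FormalLiftingFromClassLifting.WeightOne

variable {X : TopCat.{u}}

/-- Naturality of a morphism of abelian sheaves on sections, written with `sheafSecRes`.
[folklore] -/
private theorem app_sheafSecRes {F G : Sheaf (Opens.grothendieckTopology X) AddCommGrpCat.{u}}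
    (α : F ⟶ G) {V W : Opens X} (h : V ≤ W) (x : F.obj.obj (op W)) :
    α.hom.app (op V) (sheafSecRes F h x) = sheafSecRes G h (α.hom.app (op W) x) := by
  have e := ConcreteCategory.congr_hom (α.hom.naturality (homOfLE h).op) x
  simpa only [ConcreteCategory.comp_apply] using e

/-- An equality of morphisms of abelian sheaves, evaluated on a section. [folklore] -/
private theorem congr_app_apply {F G : Sheaf (Opens.grothendieckTopology X) AddCommGrpCat.{u}}
    {α β : F ⟶ G} (e : α = β) (V : Opens X) (x : F.obj.obj (op V)) :
    α.hom.app (op V) x = β.hom.app (op V) x := by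
  rw [e]

/-- A point-indexed family of open neighbourhoods covers the space. [folklore] -/
private theorem iSup_eq_top_of_mem (W : X → Opens X) (hW : ∀ x, x ∈ W x) : iSup W = ⊤ :=
  top_le_iff.mp fun x _ ↦ Opens.mem_iSup.2 ⟨x, hW x⟩

/-- A monomorphism of abelian sheaves is injective on sections. [folklore] -/
private theorem app_injective_of_mono {F G : Sheaf (Opens.grothendieckTopology X) AddCommGrpCat.{u}}
    (α : F ⟶ G) [Mono α] (V : Opens X) : Function.Injective (α.hom.app (op V)) := by
  have hm : Mono α := ‹_›
  rw [Sheaf.Hom.mono_iff_presheaf_mono, NatTrans.mono_iff_mono_app] at hm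
  exact (AddCommGrpCat.mono_iff_injective _).1 (hm _)

section ShortExact

variable {F I Q : Sheaf (Opens.grothendieckTopology X) AddCommGrpCat.{u}} {f : F ⟶ I} {g : I ⟶ Q}
  {w : f ≫ g = 0}

/-- `g ∘ f = 0` on sections. [folklore] -/
private theorem app_app_eq_zero (w : f ≫ g = 0) (V : Opens X) (x : F.obj.obj (op V)) :
    g.hom.app (op V) (f.hom.app (op V) x) = 0 :=
  congr_app_apply w V x

/-- Step THETA: for a complex `F → I → Q` (`g ∘ f = 0`) with `H¹(X, I) = 0`, a Čech `1`-cocycle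
`b` of `F` on a point-indexed open cover `W` becomes a coboundary `f(b_{xy}) = s_y - s_x` in `I`,
and the images of the `s_x` in `Q` glue to a global section `q`.
[cite: Hartshorne1977, III Lemma 4.4 (PDF p. 277)] -/
private theorem exists_lift_and_glue (w : f ≫ g = 0) [Subsingleton (I.H 1)] (W : X → Opens X)
    (hW : ∀ x, x ∈ W x)
    (b : ∀ x y : X, F.obj.obj (op (W x ⊓ W y)))
    (hb : ∀ x y z : X,
      sheafSecRes F (le_inf (inf_le_left.trans inf_le_right) inf_le_right :
          W x ⊓ W y ⊓ W z ≤ W y ⊓ W z) (b y z) -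
        sheafSecRes F (le_inf (inf_le_left.trans inf_le_left) inf_le_right :
          W x ⊓ W y ⊓ W z ≤ W x ⊓ W z) (b x z) +
        sheafSecRes F (inf_le_left : W x ⊓ W y ⊓ W z ≤ W x ⊓ W y) (b x y) = 0) :
    ∃ (s : ∀ x, I.obj.obj (op (W x))) (q : Q.obj.obj (op ⊤)),
      (∀ x y, f.hom.app (op (W x ⊓ W y)) (b x y) =
        sheafSecRes I inf_le_right (s y) - sheafSecRes I inf_le_left (s x)) ∧
      (∀ x, g.hom.app (op (W x)) (s x) = sheafSecRes Q le_top q) := by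
  obtain ⟨s, hs⟩ := exists_cech_coboundary_of_subsingleton_H_one I W (iSup_eq_top_of_mem W hW)
    (fun x y ↦ f.hom.app (op (W x ⊓ W y)) (b x y)) fun x y z ↦ by
      rw [← app_sheafSecRes, ← app_sheafSecRes, ← app_sheafSecRes, ← map_sub, ← map_add, hb,
        map_zero]
  have hcompat : TopCat.Presheaf.IsCompatible Q.obj W fun x ↦ g.hom.app (op (W x)) (s x) := by
    intro x y
    change sheafSecRes Q inf_le_left (g.hom.app (op (W x)) (s x)) =
      sheafSecRes Q inf_le_right (g.hom.app (op (W y)) (s y))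
    rw [← app_sheafSecRes, ← app_sheafSecRes, ← sub_eq_zero, ← map_sub, ← neg_sub, map_neg, ← hs,
      app_app_eq_zero w, neg_zero]
  obtain ⟨q, hq, -⟩ := TopCat.Sheaf.existsUnique_gluing' (C := AddCommGrpCat.{u}) Q W ⊤
    (fun x ↦ homOfLE le_top) (iSup_eq_top_of_mem W hW).ge _ hcompat
  exact ⟨s, q, hs, fun x ↦ (hq x).symm⟩

/-- Step INJECTIVITY: for `0 → F → I → Q → 0` short exact, sections `r_x ∈ I(W x)` whose images in
`Q` are the restrictions of a global section `q` with `δ(q) = 0` in `H¹(X, F)`, every family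
`d_{xy} ∈ F(W x ∩ W y)` with `f(d_{xy}) = r_y - r_x` is a Čech coboundary: `q` lifts to a global
section of `I` (exactness of `H⁰(I) → H⁰(Q) → H¹(F)`), the corrected `r_x` come from sections
`z_x` of `F` (left exactness of sections), and `f` is injective on sections.
[cite: Hartshorne1977, III Lemma 4.4 (PDF p. 277)] -/
private theorem exists_coboundary_of_extClass_eq_zero (hS : (ShortComplex.mk f g w).ShortExact)
    (W : X → Opens X) (r : ∀ x, I.obj.obj (op (W x))) (q : Q.obj.obj (op ⊤))
    (hr : ∀ x, g.hom.app (op (W x)) (r x) = sheafSecRes Q le_top q)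
    (hq : ((Sheaf.H.equiv₀ Q isTerminalTop).symm q).comp hS.extClass (zero_add 1) = 0)
    (d : ∀ x y : X, F.obj.obj (op (W x ⊓ W y)))
    (hd : ∀ x y, f.hom.app (op (W x ⊓ W y)) (d x y) =
      sheafSecRes I inf_le_right (r y) - sheafSecRes I inf_le_left (r x)) :
    ∃ z : ∀ x, F.obj.obj (op (W x)),
      ∀ x y, d x y = sheafSecRes F inf_le_right (z y) - sheafSecRes F inf_le_left (z x) := by
  obtain ⟨x₂, hx₂⟩ := Ext.covariant_sequence_exact₃ _ hS _ (zero_add 1) hq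
  have hG : g.hom.app (op ⊤) (Sheaf.H.equiv₀ I isTerminalTop x₂) = q := by
    have e : (ShortComplex.mk f g w).g.hom.app (op ⊤)
        (Sheaf.H.equiv₀ (ShortComplex.mk f g w).X₂ isTerminalTop x₂) = q := by
      rw [Sheaf.H.equiv₀_naturality, Sheaf.H.map_apply, hx₂, AddEquiv.apply_symm_apply]
    exact e
  have hd' : ∀ x, g.hom.app (op (W x))
      (r x - sheafSecRes I le_top (Sheaf.H.equiv₀ I isTerminalTop x₂)) = 0 := fun x ↦ by
    rw [map_sub, app_sheafSecRes, hG, hr, sub_self]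
  choose e he using fun x ↦ exists_app_eq_of_app_eq_zero_of_shortExact hS (op (W x)) _ (hd' x)
  have he' : ∀ x, f.hom.app (op (W x)) (e x) =
      r x - sheafSecRes I le_top (Sheaf.H.equiv₀ I isTerminalTop x₂) := he
  haveI : Mono f := hS.mono_f
  refine ⟨e, fun x y ↦ app_injective_of_mono f _ ?_⟩
  rw [hd, map_sub, app_sheafSecRes, app_sheafSecRes, he', he', map_sub, map_sub,
    sheafSecRes_sheafSecRes, sheafSecRes_sheafSecRes]
  abel

/-- Step SURJECTIVITY: for `0 → F → I → Q → 0` short exact with `H¹(X, I) = 0`, a basis `B` and a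
point-indexed open cover `U`, every class `ξ ∈ H¹(X, F)` is `δ(q)` for a global section `q` of `Q`
which lifts to sections `t_x ∈ I(W x)` on basic opens `x ∈ W x ≤ U x` (an epimorphism of sheaves is
locally surjective), and `b_{xy} = f⁻¹(t_y - t_x)` is a Čech `1`-cocycle of `F` on `W`.
[cite: Hartshorne1977, III Ex. 4.4 (PDF pp. 279–280)] -/
private theorem exists_cocycle_of_H_one (hS : (ShortComplex.mk f g w).ShortExact)
    [Subsingleton (I.H 1)] {B : Set (Opens X)} (hB : Opens.IsBasis B) (U : X → Opens X)
    (hU : ∀ x, x ∈ U x) (ξ : F.H 1) :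
    ∃ (W : X → Opens X) (_ : ∀ x, x ∈ W x) (_ : ∀ x, W x ≤ U x) (_ : ∀ x, W x ∈ B)
      (t : ∀ x, I.obj.obj (op (W x))) (q : Q.obj.obj (op ⊤))
      (b : ∀ x y : X, F.obj.obj (op (W x ⊓ W y))),
      (∀ x y z : X,
        sheafSecRes F (le_inf (inf_le_left.trans inf_le_right) inf_le_right :
            W x ⊓ W y ⊓ W z ≤ W y ⊓ W z) (b y z) -
          sheafSecRes F (le_inf (inf_le_left.trans inf_le_left) inf_le_right :
            W x ⊓ W y ⊓ W z ≤ W x ⊓ W z) (b x z) +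
          sheafSecRes F (inf_le_left : W x ⊓ W y ⊓ W z ≤ W x ⊓ W y) (b x y) = 0) ∧
      (∀ x y, f.hom.app (op (W x ⊓ W y)) (b x y) =
        sheafSecRes I inf_le_right (t y) - sheafSecRes I inf_le_left (t x)) ∧
      (∀ x, g.hom.app (op (W x)) (t x) = sheafSecRes Q le_top q) ∧
      ((Sheaf.H.equiv₀ Q isTerminalTop).symm q).comp hS.extClass (zero_add 1) = ξ := by
  obtain ⟨x₃, hx₃⟩ := Ext.covariant_sequence_exact₁ _ hS ξ (Subsingleton.elim _ _) (zero_add 1)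
  have hloc := (TopCat.Presheaf.isLocallySurjective_iff g.hom).mp
    ((TopCat.Sheaf.isLocallySurjective_iff_epi g).mpr hS.epi_g)
  have key : ∀ x, ∃ (W : Opens X) (t : I.obj.obj (op W)), x ∈ W ∧ W ≤ U x ∧ W ∈ B ∧
      g.hom.app (op W) t = sheafSecRes Q le_top (Sheaf.H.equiv₀ Q isTerminalTop x₃) := by
    intro x
    obtain ⟨V, hVU, ⟨s, hs⟩, hxV⟩ :=
      hloc (U x) (sheafSecRes Q le_top (Sheaf.H.equiv₀ Q isTerminalTop x₃)) x (hU x)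
    obtain ⟨W, hWB, hxW, hWV⟩ := Opens.isBasis_iff_nbhd.mp hB hxV
    refine ⟨W, sheafSecRes I hWV s, hxW, hWV.trans hVU, hWB, ?_⟩
    rw [app_sheafSecRes, hs]
    change sheafSecRes Q hWV (sheafSecRes Q hVU (sheafSecRes Q le_top _)) = _
    rw [sheafSecRes_sheafSecRes, sheafSecRes_sheafSecRes]
  choose W t hxW hWU hWB ht using key
  have hb0 : ∀ x y, g.hom.app (op (W x ⊓ W y))
      (sheafSecRes I inf_le_right (t y) - sheafSecRes I inf_le_left (t x)) = 0 := by
    intro x y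
    rw [map_sub, app_sheafSecRes, app_sheafSecRes, ht, ht, sheafSecRes_sheafSecRes,
      sheafSecRes_sheafSecRes, sub_self]
  choose b hb using fun x y ↦
    exists_app_eq_of_app_eq_zero_of_shortExact hS (op (W x ⊓ W y)) _ (hb0 x y)
  have hb' : ∀ x y, f.hom.app (op (W x ⊓ W y)) (b x y) =
      sheafSecRes I inf_le_right (t y) - sheafSecRes I inf_le_left (t x) := hb
  haveI : Mono f := hS.mono_f
  refine ⟨W, hxW, hWU, hWB, t, Sheaf.H.equiv₀ Q isTerminalTop x₃, b, fun x y z ↦ ?_, hb', ht, ?_⟩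
  · apply app_injective_of_mono f
    rw [map_add, map_sub, map_zero, app_sheafSecRes, app_sheafSecRes, app_sheafSecRes, hb', hb',
      hb', map_sub, map_sub, map_sub, sheafSecRes_sheafSecRes, sheafSecRes_sheafSecRes,
      sheafSecRes_sheafSecRes, sheafSecRes_sheafSecRes, sheafSecRes_sheafSecRes,
      sheafSecRes_sheafSecRes]
    abel
  · have e : ((Sheaf.H.equiv₀ (ShortComplex.mk f g w).X₃ isTerminalTop).symm
        (Sheaf.H.equiv₀ Q isTerminalTop x₃)).comp hS.extClass (zero_add 1) = ξ := by
      rw [AddEquiv.symm_apply_apply, hx₃]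
    exact e

end ShortExact

/-- Step NATURALITY: the connecting homomorphisms `δ : Q(X) → H¹(X, F)` of two short exact sequences
`0 → Fᵢ → Iᵢ → Qᵢ → 0` of abelian sheaves commute with a morphism `(φ, ψ, χ)` between them:
`H¹(φ)(δ₁ q) = δ₂(χ q)` (Mathlib's `ShortExact.extClass_naturality`). [folklore] -/
private theorem H_map_extClass_comp
    {F₁ I₁ Q₁ F₂ I₂ Q₂ : Sheaf (Opens.grothendieckTopology X) AddCommGrpCat.{u}}
    {f₁ : F₁ ⟶ I₁} {g₁ : I₁ ⟶ Q₁} {w₁ : f₁ ≫ g₁ = 0} {f₂ : F₂ ⟶ I₂} {g₂ : I₂ ⟶ Q₂}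
    {w₂ : f₂ ≫ g₂ = 0} (h₁ : (ShortComplex.mk f₁ g₁ w₁).ShortExact)
    (h₂ : (ShortComplex.mk f₂ g₂ w₂).ShortExact) (φ : F₁ ⟶ F₂) (ψ : I₁ ⟶ I₂) (χ : Q₁ ⟶ Q₂)
    (c₁₂ : φ ≫ f₂ = f₁ ≫ ψ) (c₂₃ : ψ ≫ g₂ = g₁ ≫ χ) (q : Q₁.obj.obj (op ⊤)) :
    Sheaf.H.map φ 1 (((Sheaf.H.equiv₀ Q₁ isTerminalTop).symm q).comp h₁.extClass (zero_add 1)) =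
      ((Sheaf.H.equiv₀ Q₂ isTerminalTop).symm (χ.hom.app (op ⊤) q)).comp h₂.extClass
        (zero_add 1) := by
  let Φ : ShortComplex.mk f₁ g₁ w₁ ⟶ ShortComplex.mk f₂ g₂ w₂ := ⟨φ, ψ, χ, c₁₂, c₂₃⟩
  rw [Sheaf.H.map_apply, ← Sheaf.H.equiv₀_symm_naturality, Sheaf.H.map_apply]
  exact Ext.comp_extClass_comp_mk₀ h₁ h₂ Φ _ (zero_add 1)

section Assembly

variable {F I Q G I' Q' : Sheaf (Opens.grothendieckTopology X) AddCommGrpCat.{u}}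
  {f : F ⟶ I} {g : I ⟶ Q} {w : f ≫ g = 0} {f' : G ⟶ I'} {g' : I' ⟶ Q'} {w' : f' ≫ g' = 0}

/-- ASSEMBLY, for an arbitrary morphism `(φ, ψ, χ)` of short exact sequences
`0 → F → I → Q → 0`, `0 → G → I' → Q' → 0` with `H¹(X, I) = H¹(X, I') = 0` and `H¹(φ)` onto: a Čech
`1`-cocycle `c` of `G` on a point-indexed cover `U` is, on a basic point-indexed refinement `W`, of
the form `φ(b) + ∂z` with `b` a Čech `1`-cocycle of `F` on `W`. With the notation of the module
docstring: `θ_G(c) = δ(q_G) = H¹(φ)(ξ)`, `ξ = δ(q_F) = θ_F(b)` on `W` (SURJECTIVITY),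
`δ(q_G - χ q_F) = 0` (NATURALITY), hence `c|_W - φ(b) = ∂z` (INJECTIVITY applied to
`r_x = s_x|_{W x} - ψ(t_x)`).
[cite: Hartshorne1977, III Lemma 4.4 and Ex. 4.4 (PDF pp. 277, 279–280)] -/
private theorem exists_refinement_cocycle_coboundary (hS : (ShortComplex.mk f g w).ShortExact)
    (hS' : (ShortComplex.mk f' g' w').ShortExact) [Subsingleton (I.H 1)] [Subsingleton (I'.H 1)]
    (φ : F ⟶ G) (ψ : I ⟶ I') (χ : Q ⟶ Q') (c₁₂ : φ ≫ f' = f ≫ ψ) (c₂₃ : ψ ≫ g' = g ≫ χ)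
    (hφ : Function.Surjective (Sheaf.H.map φ 1)) {B : Set (Opens X)} (hB : Opens.IsBasis B)
    (U : X → Opens X) (hU : ∀ x, x ∈ U x) (c : ∀ x y : X, G.obj.obj (op (U x ⊓ U y)))
    (hc : ∀ x y z : X,
      sheafSecRes G (le_inf (inf_le_left.trans inf_le_right) inf_le_right :
          U x ⊓ U y ⊓ U z ≤ U y ⊓ U z) (c y z) -
        sheafSecRes G (le_inf (inf_le_left.trans inf_le_left) inf_le_right :
          U x ⊓ U y ⊓ U z ≤ U x ⊓ U z) (c x z) +
        sheafSecRes G (inf_le_left : U x ⊓ U y ⊓ U z ≤ U x ⊓ U y) (c x y) = 0) :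
    ∃ (W : X → Opens X) (_ : ∀ x, x ∈ W x) (hWU : ∀ x, W x ≤ U x) (_ : ∀ x, W x ∈ B)
      (b : ∀ x y : X, F.obj.obj (op (W x ⊓ W y)))
      (_ : ∀ x y z : X,
        sheafSecRes F (le_inf (inf_le_left.trans inf_le_right) inf_le_right :
            W x ⊓ W y ⊓ W z ≤ W y ⊓ W z) (b y z) -
          sheafSecRes F (le_inf (inf_le_left.trans inf_le_left) inf_le_right :
            W x ⊓ W y ⊓ W z ≤ W x ⊓ W z) (b x z) +
          sheafSecRes F (inf_le_left : W x ⊓ W y ⊓ W z ≤ W x ⊓ W y) (b x y) = 0)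
      (z : ∀ x : X, G.obj.obj (op (W x))),
      ∀ x y : X,
        sheafSecRes G (inf_le_inf (hWU x) (hWU y)) (c x y) =
          φ.hom.app (op (W x ⊓ W y)) (b x y) +
            (sheafSecRes G inf_le_right (z y) - sheafSecRes G inf_le_left (z x)) := by
  -- THETA for `c`: `f'(c) = ∂s` in `I'`, the images of the `s_x` glue to `q_G ∈ Q'(X)`
  obtain ⟨s, qG, hs, hqG⟩ := exists_lift_and_glue w' U hU c hc
  -- the class `δ(q_G) ∈ H¹(G)` lifts to `ξ ∈ H¹(F)`, realised as `δ(q_F)` with `q_F` locally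
  -- lifted to `t_x ∈ I(W x)` on a basic refinement `W`, `f(b) = ∂t`
  obtain ⟨ξ, hξ⟩ := hφ (((Sheaf.H.equiv₀ Q' isTerminalTop).symm qG).comp hS'.extClass (zero_add 1))
  obtain ⟨W, hW, hWU, hWB, t, qF, b, hb, hbt, htq, hqF⟩ := exists_cocycle_of_H_one hS hB U hU ξ
  -- NATURALITY: `δ(χ q_F) = H¹(φ)(δ q_F) = δ(q_G)`
  have hnat := H_map_extClass_comp hS hS' φ ψ χ c₁₂ c₂₃ qF
  have hq : ((Sheaf.H.equiv₀ Q' isTerminalTop).symm (qG - χ.hom.app (op ⊤) qF)).comp hS'.extClass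
      (zero_add 1) = 0 := by
    rw [map_sub, sub_eq_add_neg, Ext.add_comp, Ext.neg_comp, ← hnat, hqF, hξ, add_neg_cancel]
  -- INJECTIVITY on `W` for `d = c|_W - φ(b)`: `f'(d) = ∂r` with `r_x = s_x|_{W x} - ψ(t_x)`, and
  -- `g'(r_x) = (q_G - χ q_F)|_{W x}`
  have hr : ∀ x, g'.hom.app (op (W x)) (sheafSecRes I' (hWU x) (s x) - ψ.hom.app (op (W x)) (t x)) =
      sheafSecRes Q' le_top (qG - χ.hom.app (op ⊤) qF) := fun x ↦ by
    have e : g'.hom.app (op (W x)) (ψ.hom.app (op (W x)) (t x)) =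
        χ.hom.app (op (W x)) (g.hom.app (op (W x)) (t x)) := congr_app_apply c₂₃ (W x) (t x)
    rw [map_sub, map_sub, app_sheafSecRes, hqG, sheafSecRes_sheafSecRes, e, htq, app_sheafSecRes]
  have hd : ∀ x y, f'.hom.app (op (W x ⊓ W y))
      (sheafSecRes G (inf_le_inf (hWU x) (hWU y)) (c x y) - φ.hom.app (op (W x ⊓ W y)) (b x y)) =
        sheafSecRes I' inf_le_right (sheafSecRes I' (hWU y) (s y) - ψ.hom.app (op (W y)) (t y)) -
          sheafSecRes I' inf_le_left
            (sheafSecRes I' (hWU x) (s x) - ψ.hom.app (op (W x)) (t x)) := by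
    intro x y
    have e : f'.hom.app (op (W x ⊓ W y)) (φ.hom.app (op (W x ⊓ W y)) (b x y)) =
        ψ.hom.app (op (W x ⊓ W y)) (f.hom.app (op (W x ⊓ W y)) (b x y)) :=
      congr_app_apply c₁₂ (W x ⊓ W y) (b x y)
    rw [map_sub, app_sheafSecRes, hs, e, hbt, map_sub, map_sub, map_sub, map_sub, app_sheafSecRes,
      app_sheafSecRes, sheafSecRes_sheafSecRes, sheafSecRes_sheafSecRes, sheafSecRes_sheafSecRes,
      sheafSecRes_sheafSecRes]
    abel
  obtain ⟨z, hz⟩ := exists_coboundary_of_extClass_eq_zero hS' W _ _ hr hq _ hd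
  exact ⟨W, hW, hWU, hWB, b, hb, z, fun x y ↦ by rw [← hz x y]; abel⟩

end Assembly

/-- **Čech `1`-cocycles lift along a morphism of abelian sheaves which is onto on `H¹`, after
refinement and modulo a coboundary.** For a morphism `φ : F ⟶ G` of sheaves of abelian groups on a
topological space `X` with `H¹(X, F) → H¹(X, G)` surjective (Mathlib's `Sheaf.H`), a basis `B`, a
point-indexed open cover `U` (`x ∈ U x`) and a Čech `1`-cocycle `c` of `G` on `U`, there are a
point-indexed refinement `W` of `U` by members of `B`, a Čech `1`-cocycle `b` of `F` on `W` and a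
`0`-cochain `z` of `G` on `W` with `c|_W = φ(b) + ∂z` (injectivity of `Ȟ¹(𝔚, ·) → H¹(X, ·)` on a
fixed cover, surjectivity of `colim_𝔚 Ȟ¹(𝔚, ·) → H¹(X, ·)`, and naturality, applied to injective
embeddings `F ↪ I_F`, `G ↪ I_G` and the extension `ψ : I_F → I_G` of `F → G → I_G`; see the module
docstring). [cite: Hartshorne1977, III Lemma 4.4 and Ex. 4.4 (PDF pp. 277, 279–280)] -/
theorem stub_cechOneCocycleLift :
    ∀ (X : TopCat.{u}) (F G : Sheaf (Opens.grothendieckTopology X) AddCommGrpCat.{u}) (φ : F ⟶ G),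
      Function.Surjective (Sheaf.H.map φ 1 : Sheaf.H.{u} F 1 → Sheaf.H.{u} G 1) →
      ∀ (B : Set (Opens X)), Opens.IsBasis B →
      ∀ (U : X → Opens X), (∀ x, x ∈ U x) →
      ∀ (c : ∀ x y : X, G.obj.obj (op (U x ⊓ U y))),
        (∀ x y z : X,
          sheafSecRes G (le_inf (inf_le_left.trans inf_le_right) inf_le_right :
              U x ⊓ U y ⊓ U z ≤ U y ⊓ U z) (c y z) -
            sheafSecRes G (le_inf (inf_le_left.trans inf_le_left) inf_le_right :
              U x ⊓ U y ⊓ U z ≤ U x ⊓ U z) (c x z) +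
            sheafSecRes G (inf_le_left : U x ⊓ U y ⊓ U z ≤ U x ⊓ U y) (c x y) = 0) →
        ∃ (W : X → Opens X) (_ : ∀ x, x ∈ W x) (hWU : ∀ x, W x ≤ U x) (_ : ∀ x, W x ∈ B)
          (b : ∀ x y : X, F.obj.obj (op (W x ⊓ W y)))
          (_ : ∀ x y z : X,
            sheafSecRes F (le_inf (inf_le_left.trans inf_le_right) inf_le_right :
                W x ⊓ W y ⊓ W z ≤ W y ⊓ W z) (b y z) -
              sheafSecRes F (le_inf (inf_le_left.trans inf_le_left) inf_le_right :
                W x ⊓ W y ⊓ W z ≤ W x ⊓ W z) (b x z) +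
              sheafSecRes F (inf_le_left : W x ⊓ W y ⊓ W z ≤ W x ⊓ W y) (b x y) = 0)
          (z : ∀ x : X, G.obj.obj (op (W x))),
          ∀ x y : X,
            sheafSecRes G (inf_le_inf (hWU x) (hWU y)) (c x y) =
              φ.hom.app (op (W x ⊓ W y)) (b x y) +
                (sheafSecRes G inf_le_right (z y) - sheafSecRes G inf_le_left (z x)) := by
  intro X F G φ hφ B hB U hU c hc
  -- injective embeddings `F ↪ I_F`, `G ↪ I_G` (enough injectives in the Grothendieck abelian
  -- category of abelian sheaves; `H¹` of an injective sheaf vanishes) with their quotients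
  have hSF : (ShortComplex.mk (Injective.ι F) (cokernel.π (Injective.ι F))
      (cokernel.condition _)).ShortExact :=
    { exact := ShortComplex.cokernelSequence_exact _
      mono_f := Injective.ι_mono F }
  have hSG : (ShortComplex.mk (Injective.ι G) (cokernel.π (Injective.ι G))
      (cokernel.condition _)).ShortExact :=
    { exact := ShortComplex.cokernelSequence_exact _
      mono_f := Injective.ι_mono G }
  -- the extension `ψ` of `F → G → I_G` over `F ↪ I_F` and the induced map `χ` of quotients
  obtain ⟨ψ, hψ⟩ : ∃ ψ : Injective.under F ⟶ Injective.under G,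
      φ ≫ Injective.ι G = Injective.ι F ≫ ψ :=
    ⟨Injective.factorThru (φ ≫ Injective.ι G) (Injective.ι F), (Injective.comp_factorThru _ _).symm⟩
  obtain ⟨χ, hχ⟩ : ∃ χ : cokernel (Injective.ι F) ⟶ cokernel (Injective.ι G),
      ψ ≫ cokernel.π (Injective.ι G) = cokernel.π (Injective.ι F) ≫ χ :=
    ⟨cokernel.desc _ (ψ ≫ cokernel.π (Injective.ι G))
      (by rw [← Category.assoc, ← hψ, Category.assoc, cokernel.condition, comp_zero]),
      (cokernel.π_desc _ _ _).symm⟩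
  exact exists_refinement_cocycle_coboundary hSF hSG φ ψ χ hψ hχ hφ hB U hU c hc

end Summit.HodgeConjecture.HodgeConjecture.Theorems.FormalLiftingFromClassLifting.WeightOne
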